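import Literature.AlgebraicGeometry.HodgeTheory.EigenblockSection
import HarnessLib

/-!
# The identity component `(Θ^Zar)°(K)` across an invariant splitting `M = P ⊕ Q` on which `Θ` fixes `P` pointwise: membership is
# read on the `Q`-blocks (Borel, AG I.2.1 (c) for the block section `h ↦ 1_P ⊕ h`; Springer 2.2.1 for finite index)

Basis-free `K`-points vocabulary of `AlgebraicMonodromyMumfordTate` (`glZariskiClosure`, `glIdentityComponent` of a subgroup of
`GL(M) = M ≃ₗ[K] M`), any field `K`, `M` finite-dimensional.
* `glIdentityComponent_mono` — for `Θ ≤ Γ`, `glIdentityComponent Θ ⊆ glIdentityComponent Γ` (a finite-index `Γ' ≤ Γ` meets `Θ` in a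
  finite-index subgroup of `Θ`; equality when `Θ` has finite index).
* **`mem_glIdentityComponent_of_invariant_isCompl`** — `P, Q ≤ M` complementary, `Θ ≤ GL(M)` fixing `P` pointwise and mapping `Q`
  into itself; `Θ_Q ≤ GL(Q)` the group of restrictions (characterised by `η ∈ Θ_Q ↔ ∃ θ ∈ Θ, η = θ|_Q` — no new definition); if
  `g ∈ GL(M)` fixes `P` pointwise and its restriction `g|_Q ∈ GL(Q)` lies in `glIdentityComponent Θ_Q`, then
  `g ∈ glIdentityComponent Θ`. PROOF: the block section `Φ h := 1_P ⊕ h = pr_P + ι_Q h pr_Q` has a `K[x]`-matrix formula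
  (`cst + cst·X·cst`), satisfies `Φ(θ|_Q) = θ` on `Θ`, and the tree's `mem_glIdentityComponent_of_rationalMap_end` transports.
* `exists_finiteIndex_restrict_of_finiteIndex` — a finite-index `Δ ≤ Θ_Q` pulls back to a finite-index `Θ' ≤ Θ` all of whose
  restrictions lie in `Δ` (index bookkeeping through the surjection `Θ → Θ_Q`), so that hypotheses quantified over the finite-index
  subgroups of `Θ` (e.g. strong irreducibility) pass to `Θ_Q`.
Written for the Hodge cell's crux K1Q (line «mechanism-v2», glue S3 ↔ S7: BQ-CORE lives on the variable quaternionic part `Mv`, the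
monodromy on `H² = N ⊕ Mv` with a finite-index subgroup trivial on `N`). THEOREMS only; no Hodge theory here.
[cite: Borel1991, AG I.2.1] [cite: SpringerLAG1998, 2.2.1]
-/

noncomputable section

open Module Matrix Literature.AlgebraicGeometry.Motives

namespace Literature.AlgebraicGeometry.HodgeTheory

universe u v

variable {K : Type u} [Field K] {M : Type v} [AddCommGroup M] [Module K M] [Module.Finite K M]

/-! ### §1 Finite index -/

/-- **`(Θ^Zar)° ⊆ (Γ^Zar)°` for `Θ ≤ Γ`** (monotonicity of the identity component; for `Θ` of finite index this is an equality,
Springer 2.2.1): a finite-index `Γ' ≤ Γ` meets `Θ` in a finite-index subgroup of `Θ`, whose closure lies in that of `Γ'`.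
[cite: SpringerLAG1998, 2.2.1] -/
theorem glIdentityComponent_mono {Θ Γ : Subgroup (M ≃ₗ[K] M)} (hle : Θ ≤ Γ) :
    glIdentityComponent Θ ⊆ glIdentityComponent Γ := by
  intro g hg
  rw [mem_glIdentityComponent_iff] at hg ⊢
  intro Γ' hΓ' hfi'
  have h1 : ((Γ' ⊓ Θ).subgroupOf Θ).FiniteIndex := by
    refine ⟨?_⟩
    change (Γ' ⊓ Θ).relIndex Θ ≠ 0
    rw [Subgroup.inf_relIndex_right]
    intro h0
    exact hfi'.index_ne_zero (Subgroup.relIndex_eq_zero_of_le_right hle h0)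
  exact glZariskiClosure_mono inf_le_left (hg (Γ' ⊓ Θ) inf_le_right h1)

/-! ### §2 The block section across `M = P ⊕ Q` -/

section Splitting

variable (P Q : Submodule K M)

/-- **Membership in `(Θ^Zar)°` is read on the `Q`-blocks when `Θ` fixes the complement `P` pointwise.** `P ⊕ Q = M`; `Θ ≤ GL(M)`
with `θ|_P = id` and `θ(Q) ⊆ Q` for `θ ∈ Θ`; `Θ_Q ≤ GL(Q)` the restrictions (`η ∈ Θ_Q ↔ ∃ θ ∈ Θ, η = θ|_Q`); `g ∈ GL(M)` with
`g|_P = id` whose restriction `g_Q ∈ GL(Q)` lies in `glIdentityComponent Θ_Q`. Then `g ∈ glIdentityComponent Θ`.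
[cite: Borel1991, AG I.2.1] [cite: SpringerLAG1998, 2.2.1] -/
theorem mem_glIdentityComponent_of_invariant_isCompl (hPQ : IsCompl P Q) {Θ : Subgroup (M ≃ₗ[K] M)}
    (hΘP : ∀ θ ∈ Θ, ∀ x ∈ P, θ x = x)
    (hΘQ : ∀ θ ∈ Θ, ∀ x ∈ Q, θ x ∈ Q) {ΘQ : Subgroup (Q ≃ₗ[K] Q)}
    (hΘQ' : ∀ η : Q ≃ₗ[K] Q, η ∈ ΘQ ↔ ∃ θ ∈ Θ, ∀ x : Q, ((η x : Q) : M) = θ x)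
    {g : M ≃ₗ[K] M} (hgP : ∀ x ∈ P, g x = x) {gQ : Q ≃ₗ[K] Q} (hgQ : ∀ x : Q, ((gQ x : Q) : M) = g x)
    (hg : gQ ∈ glIdentityComponent ΘQ) : g ∈ glIdentityComponent Θ := by
  classical
  -- the restriction homomorphism `ψ : Θ →* GL(Q)`
  have hΘQ₂ : ∀ θ ∈ Θ, ∀ x ∈ Q, θ.symm x ∈ Q := fun θ hθ x hx => by
    have h := hΘQ θ⁻¹ (Θ.inv_mem hθ) x hx
    exact h
  let res : ∀ θ : Θ, Q ≃ₗ[K] Q := fun θ =>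
    LinearEquiv.ofLinear (((θ : M ≃ₗ[K] M) : M →ₗ[K] M).restrict (hΘQ θ θ.2))
      ((((θ : M ≃ₗ[K] M).symm : M ≃ₗ[K] M) : M →ₗ[K] M).restrict (hΘQ₂ θ θ.2))
      (LinearMap.ext fun x => Subtype.ext (by simp)) (LinearMap.ext fun x => Subtype.ext (by simp))
  have hres : ∀ (θ : Θ) (x : Q), ((res θ x : Q) : M) = (θ : M ≃ₗ[K] M) x := fun θ x => rfl
  let ψ : Θ →* (Q ≃ₗ[K] Q) :=
    { toFun := res
      map_one' := LinearEquiv.ext fun x => Subtype.ext (by rw [hres]; rfl)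
      map_mul' := fun θ θ' => LinearEquiv.ext fun x => Subtype.ext (by rw [hres, LinearEquiv.mul_apply, hres, hres]; rfl) }
  have hψ : ∀ (θ : Θ) (x : Q), ((ψ θ x : Q) : M) = (θ : M ≃ₗ[K] M) x := fun θ x => rfl
  -- `Θ_Q` is the image of `ψ`
  have hmap : (⊤ : Subgroup Θ).map ψ = ΘQ := by
    ext η
    rw [hΘQ' η]
    constructor
    · rintro ⟨θ, -, rfl⟩
      exact ⟨θ, θ.2, fun x => hψ θ x⟩
    · rintro ⟨θ, hθ, hη⟩
      refine ⟨⟨θ, hθ⟩, Subgroup.mem_top _, LinearEquiv.ext fun x => Subtype.ext ?_⟩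
      rw [hψ, ← hη x]
  -- the section `Φ h = pr_P + ι_Q h pr_Q` and its matrix formula
  let Φ : (Q ≃ₗ[K] Q) → Module.End K M := fun h =>
    P.projection Q hPQ + Q.subtype ∘ₗ (h : Q →ₗ[K] Q) ∘ₗ Q.projectionOnto P hPQ.symm
  have hΦapp : ∀ (h : Q ≃ₗ[K] Q) (x : M), Φ h x = P.projection Q hPQ x + (h (Q.projectionOnto P hPQ.symm x) : M) :=
    fun h x => rfl
  let bQ := Module.finBasis K Q
  let c := Module.finBasis K M
  set ιQ := Fin (finrank K Q)
  let C₀ : Matrix (Fin (finrank K M)) (Fin (finrank K M)) K := LinearMap.toMatrix c c (P.projection Q hPQ)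
  let A : Matrix (Fin (finrank K M)) (Fin (finrank K Q)) K := LinearMap.toMatrix bQ c Q.subtype
  let B : Matrix (Fin (finrank K Q)) (Fin (finrank K M)) K := LinearMap.toMatrix c bQ (Q.projectionOnto P hPQ.symm)
  have hΦ : ∀ h : Q ≃ₗ[K] Q, LinearMap.toMatrix c c (Φ h) =
      (evalAtInvDet (LinearMap.toMatrix bQ bQ (h : Module.End K Q))).mapMatrix
        (cst (Fin (finrank K Q)) C₀ + cst (Fin (finrank K Q)) A * genericMatrix (Fin (finrank K Q)) K * cst (Fin (finrank K Q)) B) := by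
    intro h
    set X := LinearMap.toMatrix bQ bQ (h : Module.End K Q) with hX
    have hgM : (genericMatrix (Fin (finrank K Q)) K).map (evalAtInvDet X) = X := by
      rw [← RingHom.mapMatrix_apply, mapMatrix_genericMatrix]
    have hL : LinearMap.toMatrix c c (Φ h) = C₀ + A * X * B := by
      change LinearMap.toMatrix c c (P.projection Q hPQ + Q.subtype ∘ₗ (h : Q →ₗ[K] Q) ∘ₗ Q.projectionOnto P hPQ.symm) = _
      rw [map_add, LinearMap.toMatrix_comp c bQ c, LinearMap.toMatrix_comp c bQ bQ, Matrix.mul_assoc]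
    have hR : (evalAtInvDet X).mapMatrix (cst (Fin (finrank K Q)) C₀ + cst (Fin (finrank K Q)) A *
        genericMatrix (Fin (finrank K Q)) K * cst (Fin (finrank K Q)) B) = C₀ + A * X * B := by
      rw [map_add]
      simp only [RingHom.mapMatrix_apply, Matrix.map_mul, cst_map_evalAtInvDet, hgM]
    rw [hL, hR]
  -- `Φ (ψ θ) = θ` on `Θ`, and `Φ g_Q = g`
  have hsec : ∀ θ : Θ, Φ (ψ θ) = (((θ : M ≃ₗ[K] M)) : Module.End K M) := by
    intro θ
    refine LinearMap.ext fun x => ?_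
    have hx := Submodule.projection_add_projection_eq_self hPQ x
    have hfix : (θ : M ≃ₗ[K] M) (P.projection Q hPQ x) = P.projection Q hPQ x := hΘP _ θ.2 _ (P.projectionOnto Q hPQ x).2
    rw [hΦapp, hψ, Submodule.coe_projectionOnto_apply, LinearEquiv.coe_coe]
    conv_rhs => rw [← hx, map_add, hfix]
  have hgΦ : ((g : M ≃ₗ[K] M) : Module.End K M) = Φ gQ := by
    refine LinearMap.ext fun x => ?_
    have hx := Submodule.projection_add_projection_eq_self hPQ x
    have hfix : g (P.projection Q hPQ x) = P.projection Q hPQ x := hgP _ (P.projectionOnto Q hPQ x).2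
    rw [hΦapp, hgQ, Submodule.coe_projectionOnto_apply, LinearEquiv.coe_coe]
    conv_lhs => rw [← hx, map_add, hfix]
  rw [← hmap] at hg
  exact mem_glIdentityComponent_of_rationalMap_end bQ c Φ _ hΦ Θ ψ hsec hg hgΦ

omit [Module.Finite K M] in
/-- **Finite-index subgroups of the restriction group pull back to finite-index subgroups.** With `Θ`, `Q`, `Θ_Q` as in
`mem_glIdentityComponent_of_invariant_isCompl`: every `Δ ≤ GL(Q)` meeting `Θ_Q` with finite index contains the restrictions of a finite-index `Θ' ≤ Θ`
(namely of `Θ' = {θ ∈ Θ | θ|_Q ∈ Δ}`). So a property of `Q` holding for all finite-index subgroups of `Θ` (through their action on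
`Q`) holds for all finite-index subgroups of `Θ_Q`. [cite: SpringerLAG1998, 2.2.1] -/
theorem exists_finiteIndex_restrict_of_finiteIndex {Θ : Subgroup (M ≃ₗ[K] M)} (hΘQ : ∀ θ ∈ Θ, ∀ x ∈ Q, θ x ∈ Q)
    {ΘQ : Subgroup (Q ≃ₗ[K] Q)} (hΘQ' : ∀ η : Q ≃ₗ[K] Q, η ∈ ΘQ ↔ ∃ θ ∈ Θ, ∀ x : Q, ((η x : Q) : M) = θ x)
    {Δ : Subgroup (Q ≃ₗ[K] Q)} (hfi : (Δ.subgroupOf ΘQ).FiniteIndex) :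
    ∃ Θ' : Subgroup (M ≃ₗ[K] M), Θ' ≤ Θ ∧ (Θ'.subgroupOf Θ).FiniteIndex ∧
      ∀ θ ∈ Θ', ∃ η ∈ Δ, ∀ x : Q, ((η x : Q) : M) = θ x := by
  classical
  have hΘQ₂ : ∀ θ ∈ Θ, ∀ x ∈ Q, θ.symm x ∈ Q := fun θ hθ x hx => hΘQ θ⁻¹ (Θ.inv_mem hθ) x hx
  let res : ∀ θ : Θ, Q ≃ₗ[K] Q := fun θ =>
    LinearEquiv.ofLinear (((θ : M ≃ₗ[K] M) : M →ₗ[K] M).restrict (hΘQ θ θ.2))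
      ((((θ : M ≃ₗ[K] M).symm : M ≃ₗ[K] M) : M →ₗ[K] M).restrict (hΘQ₂ θ θ.2))
      (LinearMap.ext fun x => Subtype.ext (by simp)) (LinearMap.ext fun x => Subtype.ext (by simp))
  have hres : ∀ (θ : Θ) (x : Q), ((res θ x : Q) : M) = (θ : M ≃ₗ[K] M) x := fun θ x => rfl
  have hresmem : ∀ θ : Θ, res θ ∈ ΘQ := fun θ => (hΘQ' _).2 ⟨θ, θ.2, fun x => hres θ x⟩
  let ρ : Θ →* ΘQ :=
    { toFun := fun θ => ⟨res θ, hresmem θ⟩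
      map_one' := Subtype.ext (LinearEquiv.ext fun x => Subtype.ext (by rw [hres]; rfl))
      map_mul' := fun θ θ' => Subtype.ext (LinearEquiv.ext fun x => Subtype.ext (by
        change ((res (θ * θ') x : Q) : M) = ((res θ (res θ' x) : Q) : M)
        rw [hres, hres, hres]; rfl)) }
  have hρ : Function.Surjective ρ := by
    rintro ⟨η, hη⟩
    obtain ⟨θ, hθ, hθη⟩ := (hΘQ' η).1 hη
    refine ⟨⟨θ, hθ⟩, Subtype.ext (LinearEquiv.ext fun x => Subtype.ext ?_)⟩
    change ((res ⟨θ, hθ⟩ x : Q) : M) = ((η x : Q) : M)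
    rw [hres]
    exact (hθη x).symm
  -- `Θ' = ρ⁻¹(Δ)` as a subgroup of `GL(M)`
  refine ⟨((Δ.subgroupOf ΘQ).comap ρ).map Θ.subtype, ?_, ?_, ?_⟩
  · rintro _ ⟨θ, -, rfl⟩
    exact θ.2
  · refine ⟨?_⟩
    have h1 : (((Δ.subgroupOf ΘQ).comap ρ).map Θ.subtype).subgroupOf Θ = (Δ.subgroupOf ΘQ).comap ρ := by
      ext θ
      simp only [Subgroup.mem_subgroupOf, Subgroup.mem_map, Subgroup.mem_comap, Subgroup.coe_subtype]
      constructor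
      · rintro ⟨θ', hθ', hθθ'⟩
        rw [Subtype.ext hθθ'] at hθ'
        exact hθ'
      · intro h
        exact ⟨θ, h, rfl⟩
    rw [h1, Subgroup.index_comap_of_surjective _ hρ]
    exact hfi.index_ne_zero
  · rintro _ ⟨θ, hθ, rfl⟩
    exact ⟨res θ, Subgroup.mem_subgroupOf.1 (Subgroup.mem_comap.1 hθ), fun x => hres θ x⟩

end Splitting

end Literature.AlgebraicGeometry.HodgeTheory

end
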